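import Literature.MathematicalPhysics.QuantumFieldTheory.Balaban1983to89.B6VecIMSV1
import HarnessLib

/-!
# Route `UnitScaleTilt`, crux K1 «MinimiserStabilityRegPr» (stmt-QuantumFields-19200), route-R E′ S3 ∕ line «HKGK-ANALYTIC», row (R-loc) brick (2b) —
# SEPARABLE TEST FUNCTIONS ON THE TORUS `T^{(j)}`: for `Φ(x) = Π_i W_i(x_i)` (one real factor per coordinate, on the cyclic labels `ZMod |T|`), the Laplacian is
# `(ΔΦ)(x) = Σ_μ (Π_{i≠μ} W_i(x_i))·(2W_μ(x_μ) − W_μ(x_μ+1) − W_μ(x_μ−1))`; hence SUPPORT (`ΔΦ = 0` off the product of the rows) and SIZE (`|ΔΦ| ≤ Σ_μ K_μ·Π_{i≠μ} M_i`), and the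
# INTERIOR DUALITY `Σ_S Φ·f = Σ_S (ΔΦ)·u` for `Δu = f` on `S ⊇ supp Φ ∪ supp ΔΦ`, with its Cauchy–Schwarz reading (this seat's LOCATE-RLOC 7deca12a §2; ★w4-19200 g7 «BRICK 2 GO»)

Cell `ym3-torus`, twin-width seat `ym-ust-19936-w8` (gen 5).  THEOREMS ONLY (0 `def`, 0 `sorry`); `--supports stmt-QuantumFields-19200 --as helper`, count-neutral.  YM₃ on T³ is a
ladder rung (R3), not the Clay problem; nothing here claims S3, hKg-K, E′, the stub, the crux, d = 4 or the mass gap.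

WHY.  The blockwise inverse estimate (brick (2d)) pairs the affine source `f|_B` (✓`Prop7FlatTransposeTent.transpose_blockSiteK`) with two interior bumps `Π_i g(r_i)` and `g(r_μ)(2r_μ−s)·Π_{i≠μ} g(r_i)`
(profiles ✓`Prop7FlatBumpProfile`); what it needs from the torus side is generic in the factors: the product rule for `Δ` along the `2d` neighbours, the vanishing of `ΔΦ` off the block (each
factor vanishes off its row TOGETHER WITH its cyclic second difference), a uniform bound on the block, and `Σ Φ·Δu = Σ (ΔΦ)·u` (✓`B6VecIMSV1.sum_mul_laplace_eq_sum_pdiff`, symmetric).  All here,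
for arbitrary factors `W : Fin d → ZMod |T^{(j)}| → ℝ`.

WHAT IS PROVED (ns `…Theorems.Prop7FlatProductBump`; any `P`, level `j`, `W : Fin P.d → ZMod (P.sitesPerDir j) → ℝ`, the separable function written `fun x => ∏ i, W i (x i)`).
* §1 `sum_mul_laplace_comm` (`Σ φ·Δu = Σ (Δφ)·u`), `prod_eq_mul_prod_erase`, `prod_shift_eq`, `prod_unshift_eq` (the neighbours of a separable function).
* §2 ★★ `laplace_prod_apply` — the product rule of the title.
* §3 ★ `laplace_prod_eq_zero_off` (rows `R_i ⊂ ZMod |T|`: if every `W_i` AND its cyclic second difference vanish off `R_i`, then `ΔΦ(x) = 0` unless `∀ i, x_i ∈ R_i`), `prod_eq_zero_off`,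
  ★ `abs_laplace_prod_le` (`|W_i| ≤ M_i`, `|2W_μ − W_μ(·+1) − W_μ(·−1)| ≤ K_μ` ⇒ `|ΔΦ(x)| ≤ Σ_μ K_μ·Π_{i≠μ} M_i`).
* §4 ★★ `interior_duality` (`Φ = ΔΦ = 0` off a finset `S`, `Δu = f` on `S` ⇒ `Σ_{S} Φ·f = Σ_{S} (ΔΦ)·u`), ★★★ `sq_interior_pairing_le` (`(Σ_S Φ·f)² ≤ |S|·A²·Σ_S u²` when `|ΔΦ| ≤ A` on `S`).
HONEST SCOPE.  [folklore] finite calculus on the torus; nothing of Bałaban's is asserted; the block instance and the inverse estimate are brick (2d).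

References: T. Bałaban, CMP 95 (1984) 17–40 [Balaban1984PropagatorsI] ((1.21) p.21, Sect. C p.22); M. Giaquinta, Princeton UP 1983 [Giaquinta1984] (Ch. III §2).
-/

set_option autoImplicit false

noncomputable section

open scoped BigOperators

namespace Summit.QuantumFields.YangMills.Theorems.Prop7FlatProductBump

open Literature.MathematicalPhysics.QuantumFieldTheory.Balaban1983to89
open Finset LatticeFieldCalculus
open B6VecIMSV1 (sum_mul_laplace_eq_sum_pdiff)

variable {P : Params} {j : ℕ}

/-! ## §1 Symmetry of `Δ` and the neighbours of a separable function -/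

/-- **`Δ` IS SYMMETRIC**: `Σ_x φ(x)(Δu)(x) = Σ_x (Δφ)(x)u(x)` (both equal `Σ_μΣ_x ∂_μφ·∂_μu`). [cite: Balaban1984PropagatorsI, (1.21) p.21] -/
theorem sum_mul_laplace_comm (φ u : SiteField P j ℝ) :
    ∑ x : Site P j, φ x * laplace 1 u x = ∑ x : Site P j, laplace 1 φ x * u x := by
  rw [sum_mul_laplace_eq_sum_pdiff 1 φ u]
  rw [show ∑ x : Site P j, laplace 1 φ x * u x = ∑ x : Site P j, u x * laplace 1 φ x from Finset.sum_congr rfl fun x _ => mul_comm _ _]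
  rw [sum_mul_laplace_eq_sum_pdiff 1 u φ]
  exact Finset.sum_congr rfl fun μ _ => Finset.sum_congr rfl fun x _ => mul_comm _ _

/-- Splitting off the factor `μ`: `Π_i W_i(x_i) = W_μ(x_μ)·Π_{i≠μ} W_i(x_i)`. [folklore] -/
theorem prod_eq_mul_prod_erase (W : Fin P.d → ZMod (P.sitesPerDir j) → ℝ) (x : Site P j) (μ : Fin P.d) :
    ∏ i, W i (x i) = W μ (x μ) * ∏ i ∈ Finset.univ.erase μ, W i (x i) :=
  (Finset.mul_prod_erase Finset.univ (fun i => W i (x i)) (Finset.mem_univ μ)).symm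

/-- The forward neighbour: `Π_i W_i((x + e_μ)_i) = W_μ(x_μ + 1)·Π_{i≠μ} W_i(x_i)`. [folklore] -/
theorem prod_shift_eq (W : Fin P.d → ZMod (P.sitesPerDir j) → ℝ) (x : Site P j) (μ : Fin P.d) :
    ∏ i, W i ((x.shift μ) i) = W μ (x μ + 1) * ∏ i ∈ Finset.univ.erase μ, W i (x i) := by
  rw [prod_eq_mul_prod_erase W (x.shift μ) μ]
  have h1 : (x.shift μ) μ = x μ + 1 := by simp [Site.shift]
  rw [h1]
  congr 1
  refine Finset.prod_congr rfl fun i hi => ?_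
  have hne : i ≠ μ := Finset.ne_of_mem_erase hi
  simp [Site.shift, Function.update_of_ne hne]

/-- The backward neighbour: `Π_i W_i((x − e_μ)_i) = W_μ(x_μ − 1)·Π_{i≠μ} W_i(x_i)`. [folklore] -/
theorem prod_unshift_eq (W : Fin P.d → ZMod (P.sitesPerDir j) → ℝ) (x : Site P j) (μ : Fin P.d) :
    ∏ i, W i ((x.unshift μ) i) = W μ (x μ - 1) * ∏ i ∈ Finset.univ.erase μ, W i (x i) := by
  rw [prod_eq_mul_prod_erase W (x.unshift μ) μ]
  have h1 : (x.unshift μ) μ = x μ - 1 := by simp [Site.unshift]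
  rw [h1]
  congr 1
  refine Finset.prod_congr rfl fun i hi => ?_
  have hne : i ≠ μ := Finset.ne_of_mem_erase hi
  simp [Site.unshift, Function.update_of_ne hne]

/-! ## §2 The product rule for `Δ` -/

/-- ★★ **THE LAPLACIAN OF A SEPARABLE FUNCTION**: `(Δ Π_i W_i)(x) = Σ_μ (Π_{i≠μ} W_i(x_i))·(2W_μ(x_μ) − W_μ(x_μ + 1) − W_μ(x_μ − 1))` (`Δ = Σ_μ` (second difference along `e_μ`), and along `e_μ`
only the factor `W_μ` moves). [cite: Balaban1984PropagatorsI, (1.21) p.21] -/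
theorem laplace_prod_apply (W : Fin P.d → ZMod (P.sitesPerDir j) → ℝ) (x : Site P j) :
    laplace 1 (fun z : Site P j => ∏ i, W i (z i)) x
      = ∑ μ : Fin P.d, (∏ i ∈ Finset.univ.erase μ, W i (x i)) * (2 * W μ (x μ) - W μ (x μ + 1) - W μ (x μ - 1)) := by
  simp only [laplace, one_pow, one_smul]
  refine Finset.sum_congr rfl fun μ _ => ?_
  rw [prod_shift_eq W x μ, prod_unshift_eq W x μ, prod_eq_mul_prod_erase W x μ]
  ring

/-! ## §3 Support and size -/

/-- **A separable function vanishes off the product of the supports of its factors.** [folklore] -/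
theorem prod_eq_zero_off (W : Fin P.d → ZMod (P.sitesPerDir j) → ℝ) (R : Fin P.d → ZMod (P.sitesPerDir j) → Prop)
    (hW0 : ∀ i a, ¬ R i a → W i a = 0) (x : Site P j) (hx : ¬ ∀ i, R i (x i)) :
    ∏ i, W i (x i) = 0 := by
  push Not at hx
  obtain ⟨i, hi⟩ := hx
  exact Finset.prod_eq_zero (Finset.mem_univ i) (hW0 i (x i) hi)

/-- ★ **`ΔΦ` VANISHES OFF THE BLOCK**: if every factor `W_i` vanishes off its row `R_i` AND so does its cyclic second difference `2W_i − W_i(·+1) − W_i(·−1)` (i.e. `W_i` also vanishes at the two labels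
adjacent to the row — automatic for a profile vanishing at the row's end points), then `(Δ Π_i W_i)(x) = 0` unless `x_i ∈ R_i` for every `i`. [folklore] -/
theorem laplace_prod_eq_zero_off (W : Fin P.d → ZMod (P.sitesPerDir j) → ℝ) (R : Fin P.d → ZMod (P.sitesPerDir j) → Prop)
    (hW0 : ∀ i a, ¬ R i a → W i a = 0) (hD0 : ∀ i a, ¬ R i a → 2 * W i a - W i (a + 1) - W i (a - 1) = 0)
    (x : Site P j) (hx : ¬ ∀ i, R i (x i)) :
    laplace 1 (fun z : Site P j => ∏ i, W i (z i)) x = 0 := by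
  rw [laplace_prod_apply]
  push Not at hx
  obtain ⟨i₀, hi₀⟩ := hx
  refine Finset.sum_eq_zero fun μ _ => ?_
  by_cases hμ : μ = i₀
  · subst hμ
    rw [hD0 μ (x μ) hi₀, mul_zero]
  · have hmem : i₀ ∈ Finset.univ.erase μ := Finset.mem_erase.mpr ⟨Ne.symm hμ, Finset.mem_univ _⟩
    rw [Finset.prod_eq_zero hmem (hW0 i₀ (x i₀) hi₀), zero_mul]

/-- ★ **SIZE OF `ΔΦ`**: `|W_i| ≤ M_i` and `|2W_μ − W_μ(·+1) − W_μ(·−1)| ≤ K_μ` everywhere ⇒ `|(Δ Π_i W_i)(x)| ≤ Σ_μ K_μ·Π_{i≠μ} M_i`. [folklore] -/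
theorem abs_laplace_prod_le (W : Fin P.d → ZMod (P.sitesPerDir j) → ℝ) (M K : Fin P.d → ℝ)
    (hM : ∀ i a, |W i a| ≤ M i) (hK : ∀ i a, |2 * W i a - W i (a + 1) - W i (a - 1)| ≤ K i) (x : Site P j) :
    |laplace 1 (fun z : Site P j => ∏ i, W i (z i)) x| ≤ ∑ μ : Fin P.d, K μ * ∏ i ∈ Finset.univ.erase μ, M i := by
  rw [laplace_prod_apply]
  refine (Finset.abs_sum_le_sum_abs _ _).trans (Finset.sum_le_sum fun μ _ => ?_)
  rw [abs_mul, Finset.abs_prod, mul_comm]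
  have hM0 : ∀ i, 0 ≤ M i := fun i => (abs_nonneg _).trans (hM i (x i))
  exact mul_le_mul (hK μ (x μ)) (Finset.prod_le_prod (fun i _ => abs_nonneg _) fun i _ => hM i (x i))
    (Finset.prod_nonneg fun i _ => abs_nonneg _) ((abs_nonneg _).trans (hK μ (x μ)))

/-! ## §4 The interior duality -/

/-- ★★ **INTERIOR DUALITY**: if `Φ` and `ΔΦ` vanish off a finset `S` and `Δu = f` on `S`, then `Σ_{x∈S} Φ(x)f(x) = Σ_{x∈S} (ΔΦ)(x)u(x)` — the source is read through the test function, the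
field only through `ΔΦ`, and NOTHING outside `S` enters. [cite: Giaquinta1984, Ch. III §2; Balaban1984PropagatorsI, (1.21) p.21] -/
theorem interior_duality (Φ u f : SiteField P j ℝ) (S : Finset (Site P j))
    (hΦS : ∀ x, x ∉ S → Φ x = 0) (hΔS : ∀ x, x ∉ S → laplace 1 Φ x = 0) (hEq : ∀ x ∈ S, laplace 1 u x = f x) :
    ∑ x ∈ S, Φ x * f x = ∑ x ∈ S, laplace 1 Φ x * u x := by
  classical
  have h1 : ∑ x ∈ S, Φ x * f x = ∑ x : Site P j, Φ x * laplace 1 u x := by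
    rw [← Finset.sum_subset (Finset.subset_univ S) (fun x _ hx => by rw [hΦS x hx, zero_mul])]
    exact Finset.sum_congr rfl fun x hx => by rw [hEq x hx]
  have h2 : ∑ x ∈ S, laplace 1 Φ x * u x = ∑ x : Site P j, laplace 1 Φ x * u x := by
    rw [← Finset.sum_subset (Finset.subset_univ S) (fun x _ hx => by rw [hΔS x hx, zero_mul])]
  rw [h1, h2, sum_mul_laplace_comm]

/-- ★★★ **THE INTERIOR PAIRING IS CONTROLLED BY THE LOCAL MASS**: under the hypotheses of `interior_duality` and `|ΔΦ| ≤ A` on `S`,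
`(Σ_{x∈S} Φ(x)f(x))² ≤ |S|·A²·Σ_{x∈S} u(x)²` (Cauchy–Schwarz). [cite: Giaquinta1984, Ch. III §2] -/
theorem sq_interior_pairing_le (Φ u f : SiteField P j ℝ) (S : Finset (Site P j))
    (hΦS : ∀ x, x ∉ S → Φ x = 0) (hΔS : ∀ x, x ∉ S → laplace 1 Φ x = 0) (hEq : ∀ x ∈ S, laplace 1 u x = f x)
    {A : ℝ} (hA : ∀ x ∈ S, |laplace 1 Φ x| ≤ A) :
    (∑ x ∈ S, Φ x * f x) ^ 2 ≤ S.card * A ^ 2 * ∑ x ∈ S, u x ^ 2 := by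
  rw [interior_duality Φ u f S hΦS hΔS hEq]
  have hcs := Finset.sum_mul_sq_le_sq_mul_sq S (fun x => laplace 1 Φ x) u
  have hA2 : ∑ x ∈ S, laplace 1 Φ x ^ 2 ≤ S.card * A ^ 2 := by
    have h : ∀ x ∈ S, laplace 1 Φ x ^ 2 ≤ A ^ 2 := fun x hx => by
      have := hA x hx
      have hA0 : 0 ≤ A := (abs_nonneg _).trans this
      rw [← sq_abs]
      exact pow_le_pow_left₀ (abs_nonneg _) this 2
    calc ∑ x ∈ S, laplace 1 Φ x ^ 2 ≤ ∑ _x ∈ S, A ^ 2 := Finset.sum_le_sum h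
      _ = S.card * A ^ 2 := by rw [Finset.sum_const, nsmul_eq_mul]
  have hu : 0 ≤ ∑ x ∈ S, u x ^ 2 := Finset.sum_nonneg fun x _ => sq_nonneg _
  calc (∑ x ∈ S, laplace 1 Φ x * u x) ^ 2 ≤ (∑ x ∈ S, laplace 1 Φ x ^ 2) * ∑ x ∈ S, u x ^ 2 := hcs
    _ ≤ S.card * A ^ 2 * ∑ x ∈ S, u x ^ 2 := mul_le_mul_of_nonneg_right hA2 hu

end Summit.QuantumFields.YangMills.Theorems.Prop7FlatProductBump

end
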